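import Summits.Ventures.HSemireg.WedgeHankelRecurrenceGaussZerosProduct
import Literature.Algebra.Polynomial.ChebyshevPermutable

/-!
# Venture HSemireg — **THE PELL IDENTITY `T_{n+1}² + (1 − X²) U_n² = 1`** (Mathlib's Chebyshev polynomials, every integer `n`, any commutative ring): hence **`T_{n+1}` and `U_n` are coprime**
# (Bézout with coefficients `T_{n+1}` and `(1 − X²) U_n`), **`(1 − x²) U_n(x)² = 1 − T_{n+1}(x)² ≤ 1`** for every real `x`, and **`|U_n(x)| ≤ (√(1 − x²))⁻¹` on `(−1, 1)`**

HONEST FRAMING. Part of the Lean index of the computation cell `pub-hsemireg` (seat p10 gen 47, Sunday typer «UNIFORM-IN-n»).  Polynomial algebra and one real inequality only; no variety, no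
cohomology theory, no sheaf, no Ext group and no semiregularity map is constructed here; nothing here says that HC / HC_CM / HC_AV holds; no Literature fact (unproved `Prop`) is declared or used.
Custodian versions as in `WedgeHankelSiegelIdeal` (1/3).
SOURCES (cited).  T. J. Rivlin, *Chebyshev Polynomials* (1990), §1.2 (`T_n² − (x² − 1) U_{n−1}² = 1`), §1.3 (bounds for `U_n`); J. C. Mason, D. C. Handscomb, *Chebyshev Polynomials* (2003), §1.2.
The identity itself is the LANDED `Literature.Algebra.Polynomial.ChebyshevPermutable.T_sq_sub_X_sq_sub_one_mul_U_sq` (Rivlin (4.1)); here the index-shifted form and its corollaries.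
PROOF TYPED HERE.  `Literature…T_sq_sub_X_sq_sub_one_mul_U_sq R (n+1)` rearranged; Bézout by definition of `IsCoprime`; the real bound by `Real.abs_le_sqrt`, `Real.sqrt_inv`.
DEDUP DISCLOSURE (`rg -n -i 'pell|T_sq|isCoprime_T' Summits Literature`, 2026-09-04): `Literature/Algebra/Polynomial/ChebyshevPermutable.lean` HAS the Pell identity (`T_sq_sub_X_sq_sub_one_mul_U_sq`,
evaluated form `T_eval_sq_sub`) — imported and used, not re-proved; the corollaries (`IsCoprime`, the `U` bounds) are new; 0 hits for the 5 names below.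

WHAT IS IN THE TREE.  `Literature.Algebra.Polynomial.ChebyshevPermutable.T_sq_sub_X_sq_sub_one_mul_U_sq`, `T_eval_sq_sub`; Mathlib `abs_eval_T_real_le_one`; N432 `chebyshevTU_no_common_zero_succ`.
THIS FILE (namespace `Summit.Ventures.HSemireg.Wedge.HankelOuter` continued; CHAINED on N442; 0 definitions):
* §1208 `chebyshev_pell` (shifted restatement of the Literature identity, `n ∈ ℤ`), **`chebyshev_isCoprime_T_U`**, `chebyshev_pell_eval`, **`chebyshevU_sq_mul_le_one`**, **`abs_eval_chebyshevU_real_le`**.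
CAVEATS.  Nothing Ext-side.  New names only.
-/

open Module Polynomial
open scoped Matrix Polynomial

namespace Summit.Ventures.HSemireg.Wedge.HankelOuter

/-! ## §1208. The Pell identity for `T_{n+1}`, `U_n` -/

/-- **PELL IDENTITY (shifted form): `T_{n+1}² + (1 − X²) U_n² = 1` for every integer `n`** (any commutative ring) — from the landed `Literature…T_sq_sub_X_sq_sub_one_mul_U_sq`. [Rivlin (4.1);
Mason–Handscomb §1.2; this file, §1208] -/
theorem chebyshev_pell {R : Type*} [CommRing R] (n : ℤ) :
    Polynomial.Chebyshev.T R (n + 1) ^ 2 + (1 - Polynomial.X ^ 2) * Polynomial.Chebyshev.U R n ^ 2 = 1 := by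
  have h := Literature.Algebra.Polynomial.ChebyshevPermutable.T_sq_sub_X_sq_sub_one_mul_U_sq R (n + 1)
  rw [add_sub_cancel_right] at h
  linear_combination h

/-- **`T_{n+1}` and `U_n` are coprime** in `R[X]` (Bézout: `T_{n+1}·T_{n+1} + ((1 − X²)U_n)·U_n = 1`). [corollary; this file, §1208] -/
theorem chebyshev_isCoprime_T_U {R : Type*} [CommRing R] (n : ℤ) : IsCoprime (Polynomial.Chebyshev.T R (n + 1)) (Polynomial.Chebyshev.U R n) :=
  ⟨Polynomial.Chebyshev.T R (n + 1), (1 - Polynomial.X ^ 2) * Polynomial.Chebyshev.U R n, by linear_combination chebyshev_pell (R := R) n⟩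

/-- Evaluated form: `T_{n+1}(x)² + (1 − x²) U_n(x)² = 1`. [Rivlin §1.2; this file, §1208] -/
theorem chebyshev_pell_eval {R : Type*} [CommRing R] (n : ℤ) (x : R) :
    (Polynomial.Chebyshev.T R (n + 1)).eval x ^ 2 + (1 - x ^ 2) * (Polynomial.Chebyshev.U R n).eval x ^ 2 = 1 := by
  have h := congrArg (Polynomial.eval x) (chebyshev_pell (R := R) n)
  simp only [eval_add, eval_mul, eval_pow, eval_sub, eval_one, eval_X] at h
  exact h

/-- **`(1 − x²) U_n(x)² ≤ 1` for every real `x`** (it equals `1 − T_{n+1}(x)²`). [Rivlin §1.3; this file, §1208] -/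
theorem chebyshevU_sq_mul_le_one (n : ℤ) (x : ℝ) : (1 - x ^ 2) * (Polynomial.Chebyshev.U ℝ n).eval x ^ 2 ≤ 1 := by
  nlinarith [chebyshev_pell_eval (R := ℝ) n x, sq_nonneg ((Polynomial.Chebyshev.T ℝ (n + 1)).eval x)]

/-- **`|U_n(x)| ≤ (√(1 − x²))⁻¹` for `|x| < 1`.** [Rivlin §1.3; this file, §1208] -/
theorem abs_eval_chebyshevU_real_le (n : ℤ) {x : ℝ} (hx : |x| < 1) : |(Polynomial.Chebyshev.U ℝ n).eval x| ≤ (Real.sqrt (1 - x ^ 2))⁻¹ := by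
  have hx2 : 0 < 1 - x ^ 2 := by have := abs_lt.1 hx; nlinarith
  rw [← Real.sqrt_inv]
  refine Real.abs_le_sqrt ?_
  rw [inv_eq_one_div, le_div_iff₀ hx2]
  linarith [chebyshevU_sq_mul_le_one n x]

end Summit.Ventures.HSemireg.Wedge.HankelOuter
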